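import Literature.AnabelianGeometry.AbsoluteAnabelian.MonoidKummerMapsTLGLiftTransport
import Literature.AnabelianGeometry.AbsoluteAnabelian.MonoidKummerMapsTLGLiftReduction
import Literature.AnabelianGeometry.AbsoluteAnabelian.AbsAnabProp121viiSub
import HarnessLib

/-!
# [AbsTopIII] Prop 3.2 (iv) surjectivity / [IUTchII] Rmk 1.11.1 (i)(a)(b) FROM [AbsAnab] Prop 1.2.1 row L02
# `UnitsTransport` (proof-only bridge between the two abc-iut sub-DAGs that build `ψ̄ : K̄₁^× ⥲ K̄₂^×`)

S. Mochizuki, *Topics in absolute anabelian geometry III*, Prop. 3.2 (iv) p. 72 (kurims `paper:url-5493eb38cbb7`),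
proof pp. 72–73: the surjectivity is obtained «by considering the copy of `M ⥲ 𝒪^⊳` embedded in abelianizations
of open subgroups of `G ⥲ G_k` via local class field theory [cf. [Mzk9], Proposition 1.2.1, (iii), (iv)]» — i.e.
exactly from the bi-anabelian transport of `k̄^×` of S. Mochizuki, *The Absolute Anabelian Geometry of Hyperbolic
Curves* (2004), Prop. 1.2.1 (vi)/(vii) p. 10–11.  In the abc-iut tree the two ends are typed in two lanes:

* L4 lane (sub-DAG `plan/L4/SUBDAG-AbsAnab-Prop121vii.md`, abc-iut-w5-d198 / abc-iut-L4-d3): row L02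
  `Prop121vii.UnitsTransport` = ∃ an `α`-equivariant `ψ̄ : (AlgebraicClosure K₁)ˣ ≃* (AlgebraicClosure K₂)ˣ`
  carrying units to units and uniformisers to uniformisers;
* L6 lane (abc-iut-L6-d1, `MonoidKummerMapsTLGLift{Reduction,Transport,Levels,Gluing}`): the bi-anabelian
  statement (BA) «∃ `α`-equivariant `β : (K̄₁)⁰ ≃* (K̄₂)⁰`» from which EVERY surjectivity sentence of
  `MonoidKummerMaps.lean` follows (`galoisIsoLiftsToTMPairIsoOfMonoAnalytic_of_biAnabelianUnits`, …).

This file proves that the L4 row IMPLIES the L6 hypothesis (forget the units/uniformiser clauses, move from units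
to non-zero-divisors), hence that row L02 ALONE discharges the cone's named facts F-0410
`GaloisIsoLiftsToTMPairIsoOfMonoAnalytic` and F-0411 `TCGPairIsoLiftsOfMonoAnalytic` ([IUTchII] Rmk 1.11.1 (i)
(a)(b), consumed by [IUTchII] Prop 4.2 (i)(ii) — abc-iut-L6-t5 `GoodPrimeKummerBridge`):

* `isAlphaEquivariant_nonZeroDivisors_of_units` — an `α`-equivariant `ψ̄` on units yields an `α`-equivariant
  `β₀` on non-zero-divisors in abc-iut-L6-d1's hypothesis shape;
* `biAnabelianUnitsAbsGal_of_unitsTransport` — `UnitsTransport.{0}` ⇒ the hypothesis of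
  `biAnabelianUnits_of_absoluteGaloisGroup`, hence (BA) for arbitrary closures (`biAnabelianUnits_of_unitsTransport`);
* `galoisIsoLiftsToTMPairIsoOfMonoAnalytic_of_unitsTransport`, `tcgPairIsoLiftsOfMonoAnalytic_of_unitsTransport`,
  `tlgLifting_monoAnalytic_of_unitsTransport` — the named facts from row L02.

(The converse direction — (BA) ⇒ L02 modulo the units/uniformiser clauses — is the uniqueness file
`AbsAnabUnitsTransportUnique.lean`: any two `α`-equivariant transports differ at most by inversion.)
HONEST FRAMING: a reduction between OUR typings; classical LCFT content stays in row L02; nothing here bears on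
[IUTchIII] Cor. 3.12 and nothing asserts that abc is proved or refuted.  abc-iut seat abc-iut-L6-t13 (gen 4).
-/

noncomputable section

namespace Literature.AnabelianGeometry.AbsoluteAnabelian

open Field
open scoped nonZeroDivisors

/-- **Units ⇒ non-zero-divisors.**  An `α`-equivariant multiplicative isomorphism `ψ̄ : K̄₁ˣ ⥲ K̄₂ˣ` (L4 lane,
`Prop121vii.IsAlphaEquivariant`) yields an `α`-equivariant `β₀ : (K̄₁)⁰ ⥲ (K̄₂)⁰` in the hypothesis shape of
abc-iut-L6-d1's `biAnabelianUnits_of_absoluteGaloisGroup` (transport along `nonZeroDivisorsEquivUnits`).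
[cite: MochizukiAbsAnab2004, Prop 1.2.1 (vi) p.10] -/
theorem isAlphaEquivariant_nonZeroDivisors_of_units {k₁ k₂ : Type} [Field k₁] [Field k₂]
    (α₀ : absoluteGaloisGroup k₁ ≃ₜ* absoluteGaloisGroup k₂)
    (ψ : (AlgebraicClosure k₁)ˣ ≃* (AlgebraicClosure k₂)ˣ) (hψ : Prop121vii.IsAlphaEquivariant α₀ ψ) :
    ∃ β₀ : (AlgebraicClosure k₁)⁰ ≃* (AlgebraicClosure k₂)⁰,
      ∀ (σ : absoluteGaloisGroup k₁) (x y : (AlgebraicClosure k₁)⁰),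
        (y : AlgebraicClosure k₁) = σ • (x : AlgebraicClosure k₁) →
        ((β₀ y : (AlgebraicClosure k₂)⁰) : AlgebraicClosure k₂) =
          α₀ σ • ((β₀ x : (AlgebraicClosure k₂)⁰) : AlgebraicClosure k₂) := by
  let e₁ : (AlgebraicClosure k₁)⁰ ≃* (AlgebraicClosure k₁)ˣ := nonZeroDivisorsEquivUnits
  let e₂ : (AlgebraicClosure k₂)⁰ ≃* (AlgebraicClosure k₂)ˣ := nonZeroDivisorsEquivUnits
  refine ⟨(e₁.trans ψ).trans e₂.symm, fun σ x y hy => ?_⟩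
  have hxy : e₁ y = σ • e₁ x := by
    ext
    rw [Units.coe_smul]
    exact hy
  show ((ψ (e₁ y) : (AlgebraicClosure k₂)ˣ) : AlgebraicClosure k₂) =
    α₀ σ • ((ψ (e₁ x) : (AlgebraicClosure k₂)ˣ) : AlgebraicClosure k₂)
  rw [hxy, hψ, Units.coe_smul]

/-- **Non-zero-divisors ⇒ units** (converse bookkeeping): an `α`-equivariant `β₀ : (K̄₁)⁰ ⥲ (K̄₂)⁰` in
abc-iut-L6-d1's shape yields an `α`-equivariant `ψ̄ : K̄₁ˣ ⥲ K̄₂ˣ` in the L4 lane's sense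
(`Prop121vii.IsAlphaEquivariant`) — so abc-iut-L6-d1's glued transport is a candidate for row L02, equal to the
L02 witness as soon as it carries the uniformiser orientation (`Prop121vii.unitsTransport_unique`).
[cite: MochizukiAbsAnab2004, Prop 1.2.1 (vi) p.10] -/
theorem isAlphaEquivariant_units_of_nonZeroDivisors {k₁ k₂ : Type} [Field k₁] [Field k₂]
    (α₀ : absoluteGaloisGroup k₁ ≃ₜ* absoluteGaloisGroup k₂)
    (β₀ : (AlgebraicClosure k₁)⁰ ≃* (AlgebraicClosure k₂)⁰)
    (hβ₀ : ∀ (σ : absoluteGaloisGroup k₁) (x y : (AlgebraicClosure k₁)⁰),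
        (y : AlgebraicClosure k₁) = σ • (x : AlgebraicClosure k₁) →
        ((β₀ y : (AlgebraicClosure k₂)⁰) : AlgebraicClosure k₂) =
          α₀ σ • ((β₀ x : (AlgebraicClosure k₂)⁰) : AlgebraicClosure k₂)) :
    ∃ ψ : (AlgebraicClosure k₁)ˣ ≃* (AlgebraicClosure k₂)ˣ, Prop121vii.IsAlphaEquivariant α₀ ψ ∧
      ∀ x : (AlgebraicClosure k₁)⁰, ((ψ (nonZeroDivisorsEquivUnits x) : (AlgebraicClosure k₂)ˣ) :
        AlgebraicClosure k₂) = ((β₀ x : (AlgebraicClosure k₂)⁰) : AlgebraicClosure k₂) := by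
  let e₁ : (AlgebraicClosure k₁)⁰ ≃* (AlgebraicClosure k₁)ˣ := nonZeroDivisorsEquivUnits
  let e₂ : (AlgebraicClosure k₂)⁰ ≃* (AlgebraicClosure k₂)ˣ := nonZeroDivisorsEquivUnits
  refine ⟨(e₁.symm.trans β₀).trans e₂, fun σ x => ?_, fun x => ?_⟩
  · ext
    show ((β₀ (e₁.symm (σ • x)) : (AlgebraicClosure k₂)⁰) : AlgebraicClosure k₂) =
      ((σ : absoluteGaloisGroup k₁) |> α₀) • ((β₀ (e₁.symm x) : (AlgebraicClosure k₂)⁰) : AlgebraicClosure k₂)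
    exact hβ₀ σ (e₁.symm x) (e₁.symm (σ • x)) (by simp [e₁, Units.coe_smul])
  · show ((β₀ (e₁.symm (e₁ x)) : (AlgebraicClosure k₂)⁰) : AlgebraicClosure k₂) = _
    rw [MulEquiv.symm_apply_apply]

/-- **Row L02 ⇒ (BA), absolute-Galois-group form**: `Prop121vii.UnitsTransport` (universe `0`) supplies the
hypothesis of abc-iut-L6-d1's `biAnabelianUnits_of_absoluteGaloisGroup`.
[cite: MochizukiAbsAnab2004, Prop 1.2.1 (vii) p.11] -/
theorem biAnabelianUnitsAbsGal_of_unitsTransport (hUT : Prop121vii.UnitsTransport.{0})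
    (k₁ : Type) [Field k₁] [ValuativeRel k₁] [TopologicalSpace k₁] [IsNonarchimedeanLocalField k₁] [CharZero k₁]
    (k₂ : Type) [Field k₂] [ValuativeRel k₂] [TopologicalSpace k₂] [IsNonarchimedeanLocalField k₂] [CharZero k₂]
    (α₀ : absoluteGaloisGroup k₁ ≃ₜ* absoluteGaloisGroup k₂) :
    ∃ β₀ : (AlgebraicClosure k₁)⁰ ≃* (AlgebraicClosure k₂)⁰,
      ∀ (σ : absoluteGaloisGroup k₁) (x y : (AlgebraicClosure k₁)⁰),
        (y : AlgebraicClosure k₁) = σ • (x : AlgebraicClosure k₁) →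
        ((β₀ y : (AlgebraicClosure k₂)⁰) : AlgebraicClosure k₂) =
          α₀ σ • ((β₀ x : (AlgebraicClosure k₂)⁰) : AlgebraicClosure k₂) := by
  obtain ⟨ψ, hψ, -, -⟩ := hUT k₁ k₂ α₀
  exact isAlphaEquivariant_nonZeroDivisors_of_units α₀ ψ hψ

/-- **Row L02 ⇒ (BA) for arbitrary algebraic closures** (the hypothesis shape of abc-iut-L6-d1's
`MonoidKummerMapsTLGLiftReduction`), via `biAnabelianUnits_of_absoluteGaloisGroup`.
[cite: MochizukiAbsTopIII2015, Proposition 3.2 (iv) p.72] -/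
theorem biAnabelianUnits_of_unitsTransport (hUT : Prop121vii.UnitsTransport.{0})
    (C₁ C₂ : MLFClosure.{0}) (α : (C₁.K ≃ₐ[C₁.k] C₁.K) ≃ₜ* (C₂.K ≃ₐ[C₂.k] C₂.K)) :
    ∃ β : (C₁.K)⁰ ≃* (C₂.K)⁰, ∀ (σ : C₁.K ≃ₐ[C₁.k] C₁.K) (x y : (C₁.K)⁰), (y : C₁.K) = σ x →
      ((β y : (C₂.K)⁰) : C₂.K) = α σ ((β x : (C₂.K)⁰) : C₂.K) :=
  biAnabelianUnits_of_absoluteGaloisGroup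
    (fun k₁ _ _ _ _ _ k₂ _ _ _ _ _ α₀ => biAnabelianUnitsAbsGal_of_unitsTransport hUT k₁ k₂ α₀) C₁ C₂ α

/-- **Mono-analytic `TLG` lifting FROM row L02.** [cite: MochizukiAbsTopIII2015, Proposition 3.2 (iv) p.72] -/
theorem tlgLifting_monoAnalytic_of_unitsTransport (hUT : Prop121vii.UnitsTransport.{0})
    (P Q : GaloisMonoidPair.{0}) (hP : IsMLFGaloisMonoidPair .TLG P) (hQ : IsMLFGaloisMonoidPair .TLG Q)
    (hPm : IsOfMonoAnalyticTypeMonoid .TLG P) (hQm : IsOfMonoAnalyticTypeMonoid .TLG Q)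
    (f : P.Pi ≃ₜ* Q.Pi) : ∃ e : GaloisMonoidPair.Iso P Q, e.isoPi = f :=
  tlgLifting_monoAnalytic_of_biAnabelianUnits (biAnabelianUnits_of_unitsTransport hUT) P Q hP hQ hPm hQm f

/-- **F-0410 FROM row L02**: [IUTchII] Rmk 1.11.1 (i)(a) / [AbsTopIII] Prop 3.2 (iv) mono-analytic `TM` lifting
(abc-iut-L4-t2's `GaloisIsoLiftsToTMPairIsoOfMonoAnalytic`, consumed by [IUTchII] Prop 4.2 (i)) follows from
`Prop121vii.UnitsTransport`. [cite: Mochizuki2012, II Rmk 1.11.1 (i) p.50] -/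
theorem galoisIsoLiftsToTMPairIsoOfMonoAnalytic_of_unitsTransport (hUT : Prop121vii.UnitsTransport.{0}) :
    GaloisIsoLiftsToTMPairIsoOfMonoAnalytic :=
  galoisIsoLiftsToTMPairIsoOfMonoAnalytic_of_biAnabelianUnits (biAnabelianUnits_of_unitsTransport hUT)

/-- **F-0411 FROM row L02**: [IUTchII] Rmk 1.11.1 (i)(b) (abc-iut-L4-t2's `TCGPairIsoLiftsOfMonoAnalytic`,
consumed by [IUTchII] Prop 4.2 (ii)) follows from `Prop121vii.UnitsTransport`.
[cite: Mochizuki2012, II Rmk 1.11.1 (i) p.50] -/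
theorem tcgPairIsoLiftsOfMonoAnalytic_of_unitsTransport (hUT : Prop121vii.UnitsTransport.{0}) :
    TCGPairIsoLiftsOfMonoAnalytic :=
  tcgPairIsoLiftsOfMonoAnalytic_of_biAnabelianUnits (biAnabelianUnits_of_unitsTransport hUT)

end Literature.AnabelianGeometry.AbsoluteAnabelian

end
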